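import Summits.QuantumFields.BalabanUV.Beta.FP.RoadExplicitDefect
import Summits.QuantumFields.BalabanUV.Beta.FP.StepLawWardRows
import Summits.QuantumFields.BalabanUV.Beta.FP.PerfectKernelSymm
import Summits.QuantumFields.BalabanUV.Beta.FP.PerfectJetsTranslate
import Summits.QuantumFields.BalabanUV.Beta.FP.SymmetryKHolds

/-!
# `BalabanUV.Beta.FP.RoadWardExplicit` — road «FP» for binder row D1: THE ROAD's END FOR THE PINNED FAMILY WITH an2's ROW hR REMOVED (R-FP-9)
# AND THE FIXED-POINT DEFECT EXPLICIT — residual = {pins + rebase equations, hWj, hSDF (explicit), hasym} (`d = 3`, `Lc ≥ 2`, `r ∈ box (3+1) Lc`)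

Owner's integration step (road FP owner b2b-balaban-beta-d1-p3, gen 2; rulings R-FP-5/R-FP-8/R-FP-9).  leaf-02-g4's `FP/StepLawWardRows` re-read road FP's END
with the reflection row `hRj` REPLACED by the transposition symmetry `hTsymm` of the perfect one-step kernel, and `FP/PerfectKernelSymm.TPerfOf_swap` proved that
shape from coarse covariance of the perfect triple and SYMMETRY of the perfect table.  For the PINNED Stage-B family every one of those inputs is a tree
theorem: coarse invariance + decay of `KPerf … 1` (`SymmetryKHolds.kernelSide_KPerf_one_holds`), (St♭) of the perfect stencils (`PerfectJetsTranslate.SPerfOf_one_translate`,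
pin only), (Wt) of the perfect tables (`WPerfOf_one_translate` fed by an2's `WbalOf_translate`/`T2Of_translate` with an1's border/mixed covariances `vh₂S_translate` /
`hmixt_an1`), and the table symmetry = the limit of an2's `WbalOf_swap` (§1).  So:
* §1 `hWsymm_WPerfOf_one_pinned` (the perfect one-step table of the pinned family is swap-symmetric), `hWt_pinned` ((Wt) of the pinned wall tables),
  **`hTsymm_pinned`** (`TPerfOf Lc (KPerf …1) (SPerfOf … S 1) (WPerfOf … Wt 1) a b t = (same) b a (−t)` — NO hypothesis beyond the pins).
* §2 **`d1Drift_JsBalT2Of_pinned_ward_explicitDefect`** / `endpointExistence_JsBalT2Of_pinned_ward_explicitDefect`: `StepLawWardRows.d1Drift_JsBalOf_of_rows_ward_bounded` /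
  `endpointExistence_of_rows_ward_bounded` for the pinned family with the S- and W-slot rows (`hS_hSall_three`, `hW_hWall_three_an1_pinned`), `hTsymm` (§1),
  the `m ≥ 2` class data (`RoadRebasedHolds.hSinf_of_rebase`/`hWinf_of_rebase`), `hfub` (`StepDefectInherit.fubini_defect`) and `hDA`
  (`RoadExplicitDefect.absMoment₂_explicitDefect`) ALL SUPPLIED BY NAME.
RESULT: `D1Drift Lc (JsBalT2Of …) N μ ν` ⟸ EXACTLY {the `m = 1` pins + the `m ≥ 2` rebase equations (fixing the families of record), `hWj` (an1's hW at finite `j`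
FOR THIS FAMILY), `hSDF` for the EXPLICIT fixed-point defect (β-additivity of the perfect polarizations), `hasym` (N7)} — an2's hR is NOT an input of road FP
(kernel-checked), `hfub`/`hDA`/class data/slot rows are gone.
HONEST FRAMING (cell contract, verbatim): «discharging `BetaPertH` makes Bałaban's UV stability UNCONDITIONAL — a real constructive-QFT result; it is NOT the
continuum limit and NOT the Clay problem.»  COMPOSITION over tree theorems; proves no estimate; `hWj`/`hSDF`/`hasym` stay HYPOTHESES (all OPEN: hW is an1's row for
the RECURSIVE literal, bridge D1Tel/Q-G5-1; hSDF's suppliers REBASE-J + two-fold (SDF) are shared; hasym = N7 = road FP's own); NOT «D1 closed», NOT BetaPertH, NOT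
continuum, NOT Clay; 0 wall binders instantiated at a value; binders 0/4 (hW, hR, D1Tel, D1Rep).  [our object], 0 `def`, 0 cite, 0 sorry.
HONEST DEPENDENCY (verbatim): «continuum YM on T⁴ ⇐ BetaPertH ∧ nine spine estimates (0/9 proved); BetaPertH ⇐ (D1) ∧ (D4) ∧ CAP+tail; G-an2-4 gates asym,
D1 and NE2/3/4.»
-/

namespace Summit.QuantumFields.BalabanUV.Beta.FP.RoadWardExplicit

open Filter Topology
open Literature.MathematicalPhysics.QuantumFieldTheory
open Literature.MathematicalPhysics.QuantumFieldTheory.Balaban1983to89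
open Literature.MathematicalPhysics.QuantumFieldTheory.Balaban1983to89.Beta
open B12Beta (secondMoment)
open B12Normalization (stepBal)
open AffineAveraging (box toSite)
open DecimatedMomentSummable (AbsMoment₂)
open DressedMomentNormalisation (EKer dressedEntry)
open ExpKernelCalculus (MKer Decays VertexFamily₂ shiftK)
open PolarizationSign (WardTransversal AxisReflectionCovariant)
open OneStepResolventKernel (Fib LocStencil)
open OneStepKernelFamily (KInvStep TbalOf flipK D1Drift)
open BalabanStepJetsSucc (JsBal0Of JsBalOf)
open BalabanStepW2 (WbalOf T2Of T2Of_loc CwOf δwOf δwOf_pos WbalOf_loc₂ JsBalT2Of WbalOf_swap WbalOf_translate T2Of_translate)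
open AveragingMixedJetTables (vh₂S mixFFAt vh₂S_translate)
open FlowStep FlowStepRuns DagBinding
open RemainderChain (RemainderConst)
open HessKerDressedLimit (limTabOf limMKerOf locStencil_limStOf)
open Summit.QuantumFields.BalabanUV.Beta.HessKerDressedUnits (unitK unitS unitW unitW_apply)
open Summit.QuantumFields.BalabanUV.Beta.MixedJetTablesPlug (hmix_an1 hmixt_an1)
open Summit.QuantumFields.BalabanUV.Beta.GAN24.CombesThomas (sfStep smStep)
open Summit.QuantumFields.BalabanUV.Beta.GAN24.StencilSlotOfE3 (one_le_of_two_le)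
open Summit.QuantumFields.BalabanUV.Beta.GAN24.StencilSlotSAllThree (hS_hSall_three)
open Summit.QuantumFields.BalabanUV.Beta.GAN24.WSlotT2Tables (hB_base hW_hWall_three_an1_pinned)
open Summit.QuantumFields.BalabanUV.Beta.GAN24.SlotRowsPowBase (SPerfOf_of_eq WPerfOf_of_eq)
open Summit.QuantumFields.BalabanUV.Beta.FP.RebaseJets (rebaseS rebaseW)
open Summit.QuantumFields.BalabanUV.Beta.FP.PerfectObjectsT (KPerf SPerfOf WPerfOf TPerfOf fPerf)
open Summit.QuantumFields.BalabanUV.Beta.FP.TransportInfinityM (colOf)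
open Summit.QuantumFields.BalabanUV.Beta.FP.SymmetryKHolds (kernelSide_KPerf_one_holds)
open Summit.QuantumFields.BalabanUV.Beta.FP.PerfectJetsTranslate (SPerfOf_one_translate WPerfOf_one_translate)
open Summit.QuantumFields.BalabanUV.Beta.FP.PerfectKernelSymm (TPerfOf_swap)
open Summit.QuantumFields.BalabanUV.Beta.FP.StepDefectInherit (defect fubini_defect)
open Summit.QuantumFields.BalabanUV.Beta.FP.RoadRebasedHolds (hSinf_of_rebase hWinf_of_rebase)
open Summit.QuantumFields.BalabanUV.Beta.FP.RoadExplicitDefect (absMoment₂_explicitDefect)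
open Summit.QuantumFields.BalabanUV.Beta.FP.StepLawWardRows (d1Drift_JsBalOf_of_rows_ward_bounded endpointExistence_of_rows_ward_bounded)

noncomputable section

variable {Lc : ℕ} [NeZero Lc] {r : Fin (3 + 1) → ℕ} (hr : r ∈ box (3 + 1) Lc) (cE cVH cΛ cB : ℝ) (Tc : Fin 4 → Fin 4 → Fin 4 → Fin 4 → ℝ)
  (S : ℕ → ℕ → Fin (3 + 1) → (Fin (3 + 1) → ℤ) → MKer (3 + 1) (Fib 3))
  (Wt : ℕ → ℕ → Fin (3 + 1) → (Fin (3 + 1) → ℤ) → Fin (3 + 1) → (Fin (3 + 1) → ℤ) → MKer (3 + 1) (Fib 3))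

/-! ## §1 The transposition symmetry of the perfect one-step kernel of the pinned family — no hypothesis beyond the pins -/

/-- **(Wt) OF THE PINNED WALL TABLES** (an2's `WbalOf_translate` ∘ `T2Of_translate` with an1's `vh₂S_translate` / `hmixt_an1`; every `j`). [our object] -/
theorem hWt_pinned (hLc2 : 2 ≤ Lc) (j : ℕ) (μ : Fin (3 + 1)) (y : Fin (3 + 1) → ℤ) (ν : Fin (3 + 1)) (y' t : Fin (3 + 1) → ℤ) :
    WbalOf 3 Lc cE cVH cΛ (T2Of 3 Lc cE cVH cΛ ((Lc : ℝ) ^ (2 * (3 + 1))) cB Tc (vh₂S 3 Lc) (mixFFAt (toSite r) Lc)) (mixFFAt (toSite r) Lc) j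
        μ (y + t) ν (y' + t)
      = shiftK (-((Lc : ℤ) • t)) (WbalOf 3 Lc cE cVH cΛ (T2Of 3 Lc cE cVH cΛ ((Lc : ℝ) ^ (2 * (3 + 1))) cB Tc (vh₂S 3 Lc) (mixFFAt (toSite r) Lc))
          (mixFFAt (toSite r) Lc) j μ y ν y') :=
  WbalOf_translate (one_le_of_two_le hLc2) cE cVH cΛ
    (T2Of_translate (one_le_of_two_le hLc2) cE cVH cΛ ((Lc : ℝ) ^ (2 * (3 + 1))) cB Tc
      (fun κ u κ' u' t' => vh₂S_translate (d := 3) (one_le_of_two_le hLc2) κ u κ' u' t') (hmixt_an1 (toSite r)))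
    (hmixt_an1 (toSite r)) j μ y ν y' t

/-- **THE PERFECT ONE-STEP TABLE OF THE PINNED FAMILY IS SWAP-SYMMETRIC** (`W μ y ν y′ = W ν y′ μ y`): the limit of an2's `WbalOf_swap` (the carrier is the
swap-symmetrised table `W2SymOfK`), through the pin `hW1`. [our object] -/
theorem hWsymm_WPerfOf_one_pinned
    (hW1 : ∀ j, Wt j 1 = WbalOf 3 Lc cE cVH cΛ (T2Of 3 Lc cE cVH cΛ ((Lc : ℝ) ^ (2 * (3 + 1))) cB Tc (vh₂S 3 Lc) (mixFFAt (toSite r) Lc))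
      (mixFFAt (toSite r) Lc) j)
    (μ : Fin (3 + 1)) (y : Fin (3 + 1) → ℤ) (ν : Fin (3 + 1)) (y' : Fin (3 + 1) → ℤ) :
    WPerfOf (sfStep Lc) (smStep 3 Lc) Wt 1 μ y ν y' = WPerfOf (sfStep Lc) (smStep 3 Lc) Wt 1 ν y' μ y := by
  have e := WPerfOf_of_eq (sfStep Lc) (smStep 3 Lc) (m := 1) hW1
  rw [e]
  simp only [limTabOf]
  refine congrArg limMKerOf ?_
  funext j x z a b
  simp only [unitW_apply]
  rw [WbalOf_swap]

/-- **TRANSPOSITION SYMMETRY OF THE PERFECT ONE-STEP KERNEL OF THE PINNED FAMILY — the socket `hTsymm` of `StepLawWardRows`, DISCHARGED**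
(`PerfectKernelSymm.TPerfOf_swap` with `kernelSide_KPerf_one_holds`, the S-slot class data, `SPerfOf_one_translate`, §1's (Wt) and symmetry). [our object] -/
theorem hTsymm_pinned (hLc2 : 2 ≤ Lc)
    (hS1 : ∀ j, S j 1 = (JsBal0Of (one_le_of_two_le hLc2) cE cVH cΛ
      (WbalOf 3 Lc cE cVH cΛ (T2Of 3 Lc cE cVH cΛ ((Lc : ℝ) ^ (2 * (3 + 1))) cB Tc (vh₂S 3 Lc) (mixFFAt (toSite r) Lc)) (mixFFAt (toSite r) Lc))
      (CwOf (one_le_of_two_le hLc2) cE cVH cΛ (T2Of_loc (one_le_of_two_le hLc2) cE cVH cΛ ((Lc : ℝ) ^ (2 * (3 + 1))) cB Tc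
        (hB_base (one_le_of_two_le hLc2)) (hmix_an1 (one_le_of_two_le hLc2) hr)) (hmix_an1 (one_le_of_two_le hLc2) hr))
      (δwOf (one_le_of_two_le hLc2) cE cVH cΛ (T2Of_loc (one_le_of_two_le hLc2) cE cVH cΛ ((Lc : ℝ) ^ (2 * (3 + 1))) cB Tc
        (hB_base (one_le_of_two_le hLc2)) (hmix_an1 (one_le_of_two_le hLc2) hr)) (hmix_an1 (one_le_of_two_le hLc2) hr))
      (δwOf_pos (one_le_of_two_le hLc2) cE cVH cΛ (T2Of_loc (one_le_of_two_le hLc2) cE cVH cΛ ((Lc : ℝ) ^ (2 * (3 + 1))) cB Tc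
        (hB_base (one_le_of_two_le hLc2)) (hmix_an1 (one_le_of_two_le hLc2) hr)) (hmix_an1 (one_le_of_two_le hLc2) hr))
      (WbalOf_loc₂ (one_le_of_two_le hLc2) cE cVH cΛ (T2Of_loc (one_le_of_two_le hLc2) cE cVH cΛ ((Lc : ℝ) ^ (2 * (3 + 1))) cB Tc
        (hB_base (one_le_of_two_le hLc2)) (hmix_an1 (one_le_of_two_le hLc2) hr)) (hmix_an1 (one_le_of_two_le hLc2) hr)) j).S)
    (hW1 : ∀ j, Wt j 1 = WbalOf 3 Lc cE cVH cΛ (T2Of 3 Lc cE cVH cΛ ((Lc : ℝ) ^ (2 * (3 + 1))) cB Tc (vh₂S 3 Lc) (mixFFAt (toSite r) Lc))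
      (mixFFAt (toSite r) Lc) j)
    (a b : Fin (3 + 1)) (t : Fin (3 + 1) → ℤ) :
    TPerfOf Lc (KPerf (d := 3) Lc (sfStep Lc) (smStep 3 Lc) 1) (SPerfOf (sfStep Lc) (smStep 3 Lc) S 1) (WPerfOf (sfStep Lc) (smStep 3 Lc) Wt 1) a b t
      = TPerfOf Lc (KPerf (d := 3) Lc (sfStep Lc) (smStep 3 Lc) 1) (SPerfOf (sfStep Lc) (smStep 3 Lc) S 1) (WPerfOf (sfStep Lc) (smStep 3 Lc) Wt 1)
          b a (-t) := by
  obtain ⟨⟨δ₀, C₀, hδ₀, -, hK⟩, hKcov, -⟩ := kernelSide_KPerf_one_holds (Lc := Lc) hLc2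
  obtain ⟨Cs, cS, θS, δS, -, hθS1, hδS, hS, hSall⟩ := hS_hSall_three hLc2 cE cVH cΛ
    (WbalOf 3 Lc cE cVH cΛ (T2Of 3 Lc cE cVH cΛ ((Lc : ℝ) ^ (2 * (3 + 1))) cB Tc (vh₂S 3 Lc) (mixFFAt (toSite r) Lc)) (mixFFAt (toSite r) Lc)) _ _
    (δwOf_pos (one_le_of_two_le hLc2) cE cVH cΛ (T2Of_loc (one_le_of_two_le hLc2) cE cVH cΛ ((Lc : ℝ) ^ (2 * (3 + 1))) cB Tc
        (hB_base (one_le_of_two_le hLc2)) (hmix_an1 (one_le_of_two_le hLc2) hr)) (hmix_an1 (one_le_of_two_le hLc2) hr))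
    (WbalOf_loc₂ (one_le_of_two_le hLc2) cE cVH cΛ (T2Of_loc (one_le_of_two_le hLc2) cE cVH cΛ ((Lc : ℝ) ^ (2 * (3 + 1))) cB Tc
        (hB_base (one_le_of_two_le hLc2)) (hmix_an1 (one_le_of_two_le hLc2) hr)) (hmix_an1 (one_le_of_two_le hLc2) hr))
  have hSlim : LocStencil (SPerfOf (sfStep Lc) (smStep 3 Lc) S 1) Cs δS := by
    rw [SPerfOf_of_eq (sfStep Lc) (smStep 3 Lc) hS1]
    exact locStencil_limStOf hS hSall hθS1
  exact TPerfOf_swap (one_le_of_two_le hLc2) hK hδ₀ hKcov hSlim hδS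
    (SPerfOf_one_translate (one_le_of_two_le hLc2) cE cVH cΛ _ _ _ _ _ (sfStep Lc) (smStep 3 Lc) S hS1)
    (WPerfOf_one_translate _ (sfStep Lc) (smStep 3 Lc) Wt (hWt_pinned cE cVH cΛ cB Tc hLc2) hW1)
    (hWsymm_WPerfOf_one_pinned cE cVH cΛ cB Tc Wt hW1) a b t

/-! ## §2 Road FP's END for the pinned family: hR removed, defect explicit, slot rows and class data supplied -/

/-- **ROAD «FP», THE END FOR THE PINNED FAMILY — an2's hR REMOVED, DEFECT EXPLICIT** (`d = 3`, `2 ≤ Lc`, `r ∈ box (3+1) Lc`):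
`D1Drift Lc (JsBalT2Of …) N μ ν` ⟸ EXACTLY the `m = 1` pins + the `m ≥ 2` rebase equations (families of record), **`hWj`** (an1's hW at finite `j`, this family),
**`hSDF`** for the explicit fixed-point defect `D m := TP (m+1) − RP m − TP m`, **`hasym`** (N7).  `StepLawWardRows.d1Drift_JsBalOf_of_rows_ward_bounded` with the
S- and W-slot rows, `hTsymm` (§1), `hSinf`/`hWinf` (rebase), `hfub`/`hDA` (explicit defect) supplied BY NAME.  NOT «D1 closed». [our object] -/
theorem d1Drift_JsBalT2Of_pinned_ward_explicitDefect (hLc2 : 2 ≤ Lc)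
    (hS1 : ∀ j, S j 1 = (JsBal0Of (one_le_of_two_le hLc2) cE cVH cΛ
      (WbalOf 3 Lc cE cVH cΛ (T2Of 3 Lc cE cVH cΛ ((Lc : ℝ) ^ (2 * (3 + 1))) cB Tc (vh₂S 3 Lc) (mixFFAt (toSite r) Lc)) (mixFFAt (toSite r) Lc))
      (CwOf (one_le_of_two_le hLc2) cE cVH cΛ (T2Of_loc (one_le_of_two_le hLc2) cE cVH cΛ ((Lc : ℝ) ^ (2 * (3 + 1))) cB Tc
        (hB_base (one_le_of_two_le hLc2)) (hmix_an1 (one_le_of_two_le hLc2) hr)) (hmix_an1 (one_le_of_two_le hLc2) hr))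
      (δwOf (one_le_of_two_le hLc2) cE cVH cΛ (T2Of_loc (one_le_of_two_le hLc2) cE cVH cΛ ((Lc : ℝ) ^ (2 * (3 + 1))) cB Tc
        (hB_base (one_le_of_two_le hLc2)) (hmix_an1 (one_le_of_two_le hLc2) hr)) (hmix_an1 (one_le_of_two_le hLc2) hr))
      (δwOf_pos (one_le_of_two_le hLc2) cE cVH cΛ (T2Of_loc (one_le_of_two_le hLc2) cE cVH cΛ ((Lc : ℝ) ^ (2 * (3 + 1))) cB Tc
        (hB_base (one_le_of_two_le hLc2)) (hmix_an1 (one_le_of_two_le hLc2) hr)) (hmix_an1 (one_le_of_two_le hLc2) hr))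
      (WbalOf_loc₂ (one_le_of_two_le hLc2) cE cVH cΛ (T2Of_loc (one_le_of_two_le hLc2) cE cVH cΛ ((Lc : ℝ) ^ (2 * (3 + 1))) cB Tc
        (hB_base (one_le_of_two_le hLc2)) (hmix_an1 (one_le_of_two_le hLc2) hr)) (hmix_an1 (one_le_of_two_le hLc2) hr)) j).S)
    (hW1 : ∀ j, Wt j 1 = WbalOf 3 Lc cE cVH cΛ (T2Of 3 Lc cE cVH cΛ ((Lc : ℝ) ^ (2 * (3 + 1))) cB Tc (vh₂S 3 Lc) (mixFFAt (toSite r) Lc))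
      (mixFFAt (toSite r) Lc) j)
    (hSm : ∀ m : ℕ, 2 ≤ m → ∃ (W : ℕ → Fin (3 + 1) → (Fin (3 + 1) → ℤ) → Fin (3 + 1) → (Fin (3 + 1) → ℤ) → MKer (3 + 1) (Fib 3))
      (Cw δw : ℕ → ℝ) (hδw : ∀ j, 0 < δw j) (hW' : ∀ j, VertexFamily₂ (W j) (Lc ^ m) (Cw j) (δw j)) (h1 : 1 ≤ Lc ^ m),
      ∀ j, S j m = rebaseS Lc m (fun j' => (JsBal0Of h1 cE cVH cΛ W Cw δw hδw hW' j').S) j)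
    (hWm : ∀ m : ℕ, 2 ≤ m → ∀ j, Wt j m = rebaseW Lc m (WbalOf 3 (Lc ^ m) cE cVH cΛ
      (T2Of 3 (Lc ^ m) cE cVH cΛ (((Lc ^ m : ℕ) : ℝ) ^ (2 * (3 + 1))) cB Tc (vh₂S 3 (Lc ^ m)) (mixFFAt (toSite r) (Lc ^ m)))
      (mixFFAt (toSite r) (Lc ^ m))) j)
    (hWj : ∀ j, WardTransversal (flipK (TbalOf Lc (JsBalT2Of (one_le_of_two_le hLc2) cE cVH cΛ ((Lc : ℝ) ^ (2 * (3 + 1))) cB Tc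
      (hB_base (one_le_of_two_le hLc2)) (hmix_an1 (one_le_of_two_le hLc2) hr)) j)))
    (μ ν : Fin 4)
    (hSDF : ∀ m : ℕ, 1 ≤ m → secondMoment (defect
      (fun m => TPerfOf (Lc ^ m) (KPerf (d := 3) Lc (sfStep Lc) (smStep 3 Lc) m) (SPerfOf (sfStep Lc) (smStep 3 Lc) S m)
        (WPerfOf (sfStep Lc) (smStep 3 Lc) Wt m))
      (fun m a b z => ((Lc ^ m : ℕ) : ℝ) ^ 8 * dressedEntry (colOf (KPerf (d := 3) Lc (sfStep Lc) (smStep 3 Lc) m))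
        (TPerfOf Lc (KPerf Lc (sfStep Lc) (smStep 3 Lc) 1) (SPerfOf (sfStep Lc) (smStep 3 Lc) S 1) (WPerfOf (sfStep Lc) (smStep 3 Lc) Wt 1))
        (((Lc ^ m : ℕ) : ℤ) • z) a b) m) μ ν = 0)
    {N Cg : ℝ} (hasym : ∀ m : ℕ, 1 ≤ m → |fPerf Lc (sfStep Lc) (smStep 3 Lc) S Wt μ ν m - (m : ℝ) * stepBal N Lc| ≤ Cg) :
    D1Drift Lc (JsBalT2Of (one_le_of_two_le hLc2) cE cVH cΛ ((Lc : ℝ) ^ (2 * (3 + 1))) cB Tc (hB_base (one_le_of_two_le hLc2))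
      (hmix_an1 (one_le_of_two_le hLc2) hr)) N μ ν := by
  obtain ⟨Cs, cS, θS, δS, hθS0, hθS1, hδS, hS, hSall⟩ := hS_hSall_three hLc2 cE cVH cΛ
    (WbalOf 3 Lc cE cVH cΛ (T2Of 3 Lc cE cVH cΛ ((Lc : ℝ) ^ (2 * (3 + 1))) cB Tc (vh₂S 3 Lc) (mixFFAt (toSite r) Lc)) (mixFFAt (toSite r) Lc)) _ _
    (δwOf_pos (one_le_of_two_le hLc2) cE cVH cΛ (T2Of_loc (one_le_of_two_le hLc2) cE cVH cΛ ((Lc : ℝ) ^ (2 * (3 + 1))) cB Tc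
        (hB_base (one_le_of_two_le hLc2)) (hmix_an1 (one_le_of_two_le hLc2) hr)) (hmix_an1 (one_le_of_two_le hLc2) hr))
    (WbalOf_loc₂ (one_le_of_two_le hLc2) cE cVH cΛ (T2Of_loc (one_le_of_two_le hLc2) cE cVH cΛ ((Lc : ℝ) ^ (2 * (3 + 1))) cB Tc
        (hB_base (one_le_of_two_le hLc2)) (hmix_an1 (one_le_of_two_le hLc2) hr)) (hmix_an1 (one_le_of_two_le hLc2) hr))
  obtain ⟨Cw, cW, θW, δW, hθW0, hθW1, hδW, hW, hWall⟩ := hW_hWall_three_an1_pinned hLc2 hr cE cVH cΛ cB Tc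
  exact d1Drift_JsBalOf_of_rows_ward_bounded (one_le_of_two_le hLc2) cE cVH cΛ _ _ _ _ _ S Wt hLc2 hS1 hW1 hS hSall hW hWall hδS hδW hθS0 hθS1
    hθW0 hθW1 hWj (hTsymm_pinned hr cE cVH cΛ cB Tc S Wt hLc2 hS1 hW1) (hSinf_of_rebase cE cVH cΛ S hLc2 hSm)
    (hWinf_of_rebase hr cE cVH cΛ cB Tc Wt hLc2 hWm) (absMoment₂_explicitDefect hr cE cVH cΛ cB Tc S Wt hLc2 hS1 hW1 hSm hWm)
    (fun m _ a b z => fubini_defect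
      (TP := fun m => TPerfOf (Lc ^ m) (KPerf (d := 3) Lc (sfStep Lc) (smStep 3 Lc) m) (SPerfOf (sfStep Lc) (smStep 3 Lc) S m)
        (WPerfOf (sfStep Lc) (smStep 3 Lc) Wt m))
      (RP := fun m a b z => ((Lc ^ m : ℕ) : ℝ) ^ 8 * dressedEntry (colOf (KPerf (d := 3) Lc (sfStep Lc) (smStep 3 Lc) m))
        (TPerfOf Lc (KPerf Lc (sfStep Lc) (smStep 3 Lc) 1) (SPerfOf (sfStep Lc) (smStep 3 Lc) S 1) (WPerfOf (sfStep Lc) (smStep 3 Lc) Wt 1))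
        (((Lc ^ m : ℕ) : ℤ) • z) a b) m a b z)
    μ ν hSDF hasym

/-- **THE CELL's END STATEMENT FROM ROAD «FP» FOR THE PINNED FAMILY — hR REMOVED, DEFECT EXPLICIT**: `EndpointExistence Cn` BY TYPE from the pins +
rebase equations, `hWj` (this family), `hSDF` (explicit defect), bounded-defect asymptotics, `hβ`, (D4) `RemainderConst` with `rr ≤ stepBal`, (C), `hgen`.
NOT the continuum limit's construction. [our object] -/
theorem endpointExistence_JsBalT2Of_pinned_ward_explicitDefect (hLc2 : 2 ≤ Lc)
    (hS1 : ∀ j, S j 1 = (JsBal0Of (one_le_of_two_le hLc2) cE cVH cΛ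
      (WbalOf 3 Lc cE cVH cΛ (T2Of 3 Lc cE cVH cΛ ((Lc : ℝ) ^ (2 * (3 + 1))) cB Tc (vh₂S 3 Lc) (mixFFAt (toSite r) Lc)) (mixFFAt (toSite r) Lc))
      (CwOf (one_le_of_two_le hLc2) cE cVH cΛ (T2Of_loc (one_le_of_two_le hLc2) cE cVH cΛ ((Lc : ℝ) ^ (2 * (3 + 1))) cB Tc
        (hB_base (one_le_of_two_le hLc2)) (hmix_an1 (one_le_of_two_le hLc2) hr)) (hmix_an1 (one_le_of_two_le hLc2) hr))
      (δwOf (one_le_of_two_le hLc2) cE cVH cΛ (T2Of_loc (one_le_of_two_le hLc2) cE cVH cΛ ((Lc : ℝ) ^ (2 * (3 + 1))) cB Tc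
        (hB_base (one_le_of_two_le hLc2)) (hmix_an1 (one_le_of_two_le hLc2) hr)) (hmix_an1 (one_le_of_two_le hLc2) hr))
      (δwOf_pos (one_le_of_two_le hLc2) cE cVH cΛ (T2Of_loc (one_le_of_two_le hLc2) cE cVH cΛ ((Lc : ℝ) ^ (2 * (3 + 1))) cB Tc
        (hB_base (one_le_of_two_le hLc2)) (hmix_an1 (one_le_of_two_le hLc2) hr)) (hmix_an1 (one_le_of_two_le hLc2) hr))
      (WbalOf_loc₂ (one_le_of_two_le hLc2) cE cVH cΛ (T2Of_loc (one_le_of_two_le hLc2) cE cVH cΛ ((Lc : ℝ) ^ (2 * (3 + 1))) cB Tc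
        (hB_base (one_le_of_two_le hLc2)) (hmix_an1 (one_le_of_two_le hLc2) hr)) (hmix_an1 (one_le_of_two_le hLc2) hr)) j).S)
    (hW1 : ∀ j, Wt j 1 = WbalOf 3 Lc cE cVH cΛ (T2Of 3 Lc cE cVH cΛ ((Lc : ℝ) ^ (2 * (3 + 1))) cB Tc (vh₂S 3 Lc) (mixFFAt (toSite r) Lc))
      (mixFFAt (toSite r) Lc) j)
    (hSm : ∀ m : ℕ, 2 ≤ m → ∃ (W : ℕ → Fin (3 + 1) → (Fin (3 + 1) → ℤ) → Fin (3 + 1) → (Fin (3 + 1) → ℤ) → MKer (3 + 1) (Fib 3))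
      (Cw δw : ℕ → ℝ) (hδw : ∀ j, 0 < δw j) (hW' : ∀ j, VertexFamily₂ (W j) (Lc ^ m) (Cw j) (δw j)) (h1 : 1 ≤ Lc ^ m),
      ∀ j, S j m = rebaseS Lc m (fun j' => (JsBal0Of h1 cE cVH cΛ W Cw δw hδw hW' j').S) j)
    (hWm : ∀ m : ℕ, 2 ≤ m → ∀ j, Wt j m = rebaseW Lc m (WbalOf 3 (Lc ^ m) cE cVH cΛ
      (T2Of 3 (Lc ^ m) cE cVH cΛ (((Lc ^ m : ℕ) : ℝ) ^ (2 * (3 + 1))) cB Tc (vh₂S 3 (Lc ^ m)) (mixFFAt (toSite r) (Lc ^ m)))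
      (mixFFAt (toSite r) (Lc ^ m))) j)
    (hWj : ∀ j, WardTransversal (flipK (TbalOf Lc (JsBalT2Of (one_le_of_two_le hLc2) cE cVH cΛ ((Lc : ℝ) ^ (2 * (3 + 1))) cB Tc
      (hB_base (one_le_of_two_le hLc2)) (hmix_an1 (one_le_of_two_le hLc2) hr)) j)))
    (μ ν : Fin 4)
    (hSDF : ∀ m : ℕ, 1 ≤ m → secondMoment (defect
      (fun m => TPerfOf (Lc ^ m) (KPerf (d := 3) Lc (sfStep Lc) (smStep 3 Lc) m) (SPerfOf (sfStep Lc) (smStep 3 Lc) S m)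
        (WPerfOf (sfStep Lc) (smStep 3 Lc) Wt m))
      (fun m a b z => ((Lc ^ m : ℕ) : ℝ) ^ 8 * dressedEntry (colOf (KPerf (d := 3) Lc (sfStep Lc) (smStep 3 Lc) m))
        (TPerfOf Lc (KPerf Lc (sfStep Lc) (smStep 3 Lc) 1) (SPerfOf (sfStep Lc) (smStep 3 Lc) S 1) (WPerfOf (sfStep Lc) (smStep 3 Lc) Wt 1))
        (((Lc ^ m : ℕ) : ℤ) • z) a b) m) μ ν = 0)
    {N Cg : ℝ} (hasym : ∀ m : ℕ, 1 ≤ m → |fPerf Lc (sfStep Lc) (smStep 3 Lc) S Wt μ ν m - (m : ℝ) * stepBal N Lc| ≤ Cg)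
    {β : HBeta} {Cn : B12.Construction} (hgen : ForwardGenerated Cn β) (Sβ : B12Beta.OneLoopSplit β)
    (hβ : ∀ j, Sβ.β0 j = B12Beta.secondMoment (TbalOf Lc (JsBalT2Of (one_le_of_two_le hLc2) cE cVH cΛ ((Lc : ℝ) ^ (2 * (3 + 1))) cB Tc
      (hB_base (one_le_of_two_le hLc2)) (hmix_an1 (one_le_of_two_le hLc2) hr)) j) μ ν)
    {rr γ₀ : ℝ} (hγ₀ : 0 < γ₀) (hrem : RemainderConst Sβ γ₀ rr) (hr' : rr ≤ stepBal N Lc) (hcont : BetaContH γ₀ β) :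
    EndpointExistence Cn := by
  obtain ⟨Cs, cS, θS, δS, hθS0, hθS1, hδS, hS, hSall⟩ := hS_hSall_three hLc2 cE cVH cΛ
    (WbalOf 3 Lc cE cVH cΛ (T2Of 3 Lc cE cVH cΛ ((Lc : ℝ) ^ (2 * (3 + 1))) cB Tc (vh₂S 3 Lc) (mixFFAt (toSite r) Lc)) (mixFFAt (toSite r) Lc)) _ _
    (δwOf_pos (one_le_of_two_le hLc2) cE cVH cΛ (T2Of_loc (one_le_of_two_le hLc2) cE cVH cΛ ((Lc : ℝ) ^ (2 * (3 + 1))) cB Tc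
        (hB_base (one_le_of_two_le hLc2)) (hmix_an1 (one_le_of_two_le hLc2) hr)) (hmix_an1 (one_le_of_two_le hLc2) hr))
    (WbalOf_loc₂ (one_le_of_two_le hLc2) cE cVH cΛ (T2Of_loc (one_le_of_two_le hLc2) cE cVH cΛ ((Lc : ℝ) ^ (2 * (3 + 1))) cB Tc
        (hB_base (one_le_of_two_le hLc2)) (hmix_an1 (one_le_of_two_le hLc2) hr)) (hmix_an1 (one_le_of_two_le hLc2) hr))
  obtain ⟨Cw, cW, θW, δW, hθW0, hθW1, hδW, hW, hWall⟩ := hW_hWall_three_an1_pinned hLc2 hr cE cVH cΛ cB Tc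
  exact endpointExistence_of_rows_ward_bounded (one_le_of_two_le hLc2) cE cVH cΛ _ _ _ _ _ S Wt hLc2 hS1 hW1 hS hSall hW hWall hδS hδW hθS0 hθS1
    hθW0 hθW1 hWj (hTsymm_pinned hr cE cVH cΛ cB Tc S Wt hLc2 hS1 hW1) (hSinf_of_rebase cE cVH cΛ S hLc2 hSm)
    (hWinf_of_rebase hr cE cVH cΛ cB Tc Wt hLc2 hWm) (absMoment₂_explicitDefect hr cE cVH cΛ cB Tc S Wt hLc2 hS1 hW1 hSm hWm)
    (fun m _ a b z => fubini_defect
      (TP := fun m => TPerfOf (Lc ^ m) (KPerf (d := 3) Lc (sfStep Lc) (smStep 3 Lc) m) (SPerfOf (sfStep Lc) (smStep 3 Lc) S m)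
        (WPerfOf (sfStep Lc) (smStep 3 Lc) Wt m))
      (RP := fun m a b z => ((Lc ^ m : ℕ) : ℝ) ^ 8 * dressedEntry (colOf (KPerf (d := 3) Lc (sfStep Lc) (smStep 3 Lc) m))
        (TPerfOf Lc (KPerf Lc (sfStep Lc) (smStep 3 Lc) 1) (SPerfOf (sfStep Lc) (smStep 3 Lc) S 1) (WPerfOf (sfStep Lc) (smStep 3 Lc) Wt 1))
        (((Lc ^ m : ℕ) : ℤ) • z) a b) m a b z)
    μ ν hSDF hasym hgen Sβ hβ hγ₀ hrem hr' hcont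

end

end Summit.QuantumFields.BalabanUV.Beta.FP.RoadWardExplicit
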